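import Summits.Ventures.PercRepro.HallDisjointKneser

/-!
# PercRepro — HALL'S CONDITION FOR DISJOINTNESS ON THE PAIRS MEETING A SET (the nullity-one configurations)
(p10, gen 4; `proofs/P10-HALLROW.md` §5, nullity 1: the co-independent pairs are the pairs meeting the circuit `D`)

For `D ⊆ E` let `pairsMeeting E D` be the 2-subsets of `E` meeting `D`.  With `m := #D`, `c := #(E ∖ D)`:
`#pairsMeeting = C(m+c, 2) − C(c, 2)`, every point has degree `≤ m + c − 1`, and every member is disjoint from at
least `C(m+c−2, 2) − C(c, 2)` members.  So `hall_disjoint_pairs` applies as soon as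
`(4 ≤ m ∧ 2 ≤ c) ∨ (m = 3 ∧ 4 ≤ c) ∨ 6 ≤ m`; when `c ≤ 1` the family is all the pairs (`hall_disjoint_all_pairs`).
The two remaining configurations `(m, c) = (3, 2), (3, 3)` are NOT here.

* `pairsMeeting` and its cardinality `card_pairsMeeting`;
* `deg_le` — the degree bound;  `card_disjFrom_ge` — the disjointness bound;
* `two_choose_two` — `2 · C(x, 2) = x · (x − 1)`;
* **`hall_disjoint_meets`** — Hall's condition outside the two small configurations.
-/

namespace PercRepro.HallDisjoint

open Finset

variable {α : Type} [DecidableEq α]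

/-- The 2-subsets of `E` meeting `D`. -/
def pairsMeeting (E D : Finset α) : Finset (Finset α) := (E.powersetCard 2).filter (fun C => ¬ Disjoint C D)

/-- Membership in `pairsMeeting`. -/
theorem mem_pairsMeeting {E D C : Finset α} :
    C ∈ pairsMeeting E D ↔ (C ⊆ E ∧ C.card = 2) ∧ ¬ Disjoint C D := by
  unfold pairsMeeting
  rw [mem_filter, mem_powersetCard]

/-- `pairsMeeting E D` is the complement of the pairs inside `E ∖ D`. -/
theorem pairsMeeting_eq_sdiff (E D : Finset α) :
    pairsMeeting E D = E.powersetCard 2 \ (E \ D).powersetCard 2 := by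
  ext C
  rw [mem_pairsMeeting, mem_sdiff, mem_powersetCard, mem_powersetCard]
  constructor
  · rintro ⟨h, hnd⟩
    refine ⟨h, fun h' => hnd ?_⟩
    exact disjoint_of_subset_left h'.1 sdiff_disjoint
  · rintro ⟨h, hn⟩
    refine ⟨h, fun hd => hn ⟨?_, h.2⟩⟩
    intro x hx
    rw [mem_sdiff]
    exact ⟨h.1 hx, fun hxD => disjoint_left.1 hd hx hxD⟩

/-- `#pairsMeeting E D = C(#E, 2) − C(#(E ∖ D), 2)`. -/
theorem card_pairsMeeting (E D : Finset α) :
    (pairsMeeting E D).card = E.card.choose 2 - (E \ D).card.choose 2 := by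
  rw [pairsMeeting_eq_sdiff, card_sdiff_of_subset (powersetCard_mono sdiff_subset), card_powersetCard,
    card_powersetCard]

/-- Every point has degree at most `#E − 1` in any family of 2-subsets of `E`. -/
theorem deg_le {E : Finset α} {𝒞 : Finset (Finset α)} (h𝒞 : 𝒞 ⊆ E.powersetCard 2) (p : α) :
    deg 𝒞 p ≤ E.card - 1 := by
  unfold deg
  by_cases hp : p ∈ E
  · calc ((𝒞.filter (fun C => p ∈ C)).card)
        ≤ ((E.erase p).powersetCard 1).card := by
          apply card_le_card_of_injOn (fun C => C.erase p)
          · intro C hC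
            rw [Finset.mem_coe, mem_filter] at hC
            have hC' := mem_powersetCard.1 (h𝒞 hC.1)
            rw [Finset.mem_coe, mem_powersetCard]
            exact ⟨erase_subset_erase p hC'.1, by rw [card_erase_of_mem hC.2, hC'.2]⟩
          · intro C hC C' hC' h
            rw [Finset.mem_coe, mem_filter] at hC hC'
            simp only at h
            rw [← insert_erase hC.2, ← insert_erase hC'.2, h]
      _ = E.card - 1 := by rw [card_powersetCard, card_erase_of_mem hp, Nat.choose_one_right]
  · have : 𝒞.filter (fun C => p ∈ C) = ∅ := by
      rw [filter_eq_empty_iff]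
      intro C hC hpC
      exact hp ((mem_powersetCard.1 (h𝒞 hC)).1 hpC)
    rw [this, card_empty]
    exact Nat.zero_le _

/-- Every member of `pairsMeeting E D` is disjoint from at least `C(#E − 2, 2) − C(#(E ∖ D), 2)` members. -/
theorem card_disjFrom_ge (E D : Finset α) {C : Finset α} (hC : C ∈ pairsMeeting E D) :
    (E.card - 2).choose 2 - (E \ D).card.choose 2 ≤ (disjFrom (pairsMeeting E D) C).card := by
  have hC' := mem_pairsMeeting.1 hC
  have hsub : pairsMeeting (E \ C) D ⊆ disjFrom (pairsMeeting E D) C := by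
    intro C' hC'
    rw [mem_pairsMeeting] at hC'
    unfold disjFrom
    rw [mem_filter, mem_pairsMeeting]
    refine ⟨⟨⟨hC'.1.1.trans sdiff_subset, hC'.1.2⟩, hC'.2⟩, ?_⟩
    exact disjoint_of_subset_right hC'.1.1 disjoint_sdiff
  calc (E.card - 2).choose 2 - (E \ D).card.choose 2
      ≤ (E \ C).card.choose 2 - ((E \ C) \ D).card.choose 2 := by
        rw [card_sdiff_of_subset hC'.1.1, hC'.1.2]
        apply Nat.sub_le_sub_left
        apply Nat.choose_le_choose
        apply card_le_card
        exact sdiff_subset_sdiff sdiff_subset (subset_refl D)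
    _ = (pairsMeeting (E \ C) D).card := (card_pairsMeeting (E \ C) D).symm
    _ ≤ (disjFrom (pairsMeeting E D) C).card := card_le_card hsub

/-- `2 · C(x, 2) = x · (x − 1)`. -/
theorem two_choose_two (x : ℕ) : 2 * x.choose 2 = x * (x - 1) := by
  rcases Nat.eq_zero_or_pos x with h | h
  · subst h
    rfl
  · obtain ⟨y, rfl⟩ : ∃ y, x = y + 1 := ⟨x - 1, by omega⟩
    have h := Nat.add_one_mul_choose_eq y 1
    rw [Nat.choose_one_right] at h
    calc 2 * (y + 1).choose 2 = (y + 1).choose 2 * 2 := by ring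
      _ = (y + 1) * y := h.symm
      _ = (y + 1) * (y + 1 - 1) := by rw [Nat.add_sub_cancel]

/-- The arithmetic of (G1) for the pairs meeting `D`: `m = m' + 3`, `c = c' + 2`. -/
theorem arith_G1 (m' c' : ℕ) (h : 1 ≤ m' ∨ 2 ≤ c') :
    (c' + 2).choose 2 + 4 ≤ (m' + c' + 3).choose 2 := by
  have h1 := two_choose_two (c' + 2)
  have h2 := two_choose_two (m' + c' + 3)
  rw [show c' + 2 - 1 = c' + 1 by omega] at h1
  rw [show m' + c' + 3 - 1 = m' + c' + 2 by omega] at h2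
  rcases h with h | h <;> nlinarith

/-- The arithmetic of (G2) for the pairs meeting `D`: `2 · (#E − 1) + 1 ≤ #𝒞`. -/
theorem arith_G2 (m' c' : ℕ) :
    (c' + 2).choose 2 + (2 * (m' + c' + 4) + 1) ≤ (m' + c' + 5).choose 2 := by
  have h1 := two_choose_two (c' + 2)
  have h2 := two_choose_two (m' + c' + 5)
  rw [show c' + 2 - 1 = c' + 1 by omega] at h1
  rw [show m' + c' + 5 - 1 = m' + c' + 4 by omega] at h2
  nlinarith

/-- **Hall's condition for disjointness on the pairs meeting `D`**, for `D ⊆ E` with `m := #D`, `c := #(E ∖ D)`,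
outside the two configurations `(m, c) ∈ {(3, 2), (3, 3)}`: if `3 ≤ m` and `4 ≤ #E` and not `(m = 3 ∧ c ∈ {2, 3})`,
then every `𝒜 ⊆ pairsMeeting E D` has at least `#𝒜` members disjoint from some member of `𝒜`. -/
theorem hall_disjoint_meets {E D : Finset α} (hD : D ⊆ E) (hm : 3 ≤ D.card) (hE : 4 ≤ E.card)
    (hexc : ¬ (D.card = 3 ∧ (E \ D).card = 2)) (hexc' : ¬ (D.card = 3 ∧ (E \ D).card = 3))
    {𝒜 : Finset (Finset α)} (h𝒜 : 𝒜 ⊆ pairsMeeting E D) :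
    𝒜.card ≤ (nbr (pairsMeeting E D) 𝒜).card := by
  have hcard : (E \ D).card + D.card = E.card := card_sdiff_add_card_eq_card hD
  rcases Nat.lt_or_ge (E \ D).card 2 with hc | hc
  · have heq : pairsMeeting E D = E.powersetCard 2 := by
      rw [pairsMeeting_eq_sdiff]
      have : (E \ D).powersetCard 2 = ∅ := by
        rw [powersetCard_eq_empty]
        omega
      rw [this, sdiff_empty]
    rw [heq] at h𝒜 ⊢
    exact hall_disjoint_all_pairs E hE h𝒜
  · obtain ⟨m', hm'⟩ : ∃ m', D.card = m' + 3 := ⟨D.card - 3, by omega⟩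
    obtain ⟨c', hc'⟩ : ∃ c', (E \ D).card = c' + 2 := ⟨(E \ D).card - 2, by omega⟩
    have hcase : 1 ≤ m' ∨ 2 ≤ c' := by omega
    have hEc : E.card = m' + c' + 5 := by omega
    apply hall_disjoint_pairs (pairsMeeting E D) (fun C hC => (mem_pairsMeeting.1 hC).1.2) _ _ _ h𝒜
    · intro C hC
      refine le_trans ?_ (card_disjFrom_ge E D hC)
      rw [hEc, hc', show m' + c' + 5 - 2 = m' + c' + 3 by omega]
      have h3 := arith_G1 m' c' hcase
      omega
    · intro p
      have hdeg := deg_le (E := E) (𝒞 := pairsMeeting E D) (filter_subset _ _) p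
      rw [card_pairsMeeting, hEc, hc']
      have h3 := arith_G2 m' c'
      omega
    · rw [card_pairsMeeting, hEc, hc']
      have h3 := arith_G2 m' c'
      omega

end PercRepro.HallDisjoint
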